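import Summits.QuantumFields.BalabanUV.Beta.GAN24.CoDressedColumnPointInversion
import Literature.MathematicalPhysics.QuantumFieldTheory.Balaban1983to89.Beta.RootedKernelReflection

/-!
# `BalabanUV.Beta.GAN24.ConstraintHessianPointInversion` — binder row G-an2-4 ∕ (CONV-C), the (S) row of RULING R-gan24p1-g27-1 PART B (viii), sub-step
# (INV-X) ∕ (INV-Z), MULTIPLIER HALF: **THE ROOTED CONSTRAINT HESSIAN `hessFFAt` — HENCE THE FIRST MULTIPLIER TABLE `M1At` — IS POINT-INVERSION
# COVARIANT AT THE CENTRED ROOT, AND ITS ω-CHARGES IN THE CLASS `span{1, exit} ⊗ span{1, exit}` OBEY ROAD-P2's `hZM` WITH `t′ = −1`, `ω′ = ω`**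

NOT IN PRINT; OUR BOOKKEEPING ([folklore] `d + 1` rewrites by an1∕an5's axis law `RootedKernelReflection.hessFFAt_reflect` (centred root, `Lc` odd) iterated over a finite
set of axes, one block translation `AveragingHessianKernelsRooted.hessFFAt_translate`, and one re-indexing of a `Site × Site` sum by an involution; 0 `def`, 0 cited
fact, 0 `def … : Prop`, 0 sorry).  Companion of `CoDressedColumnPointInversion` ((INV-G)); the OWNER gan24-p1 g28's RULING R-gan24p1-g28-1 (v): «for `M1 = HFF` entrywise
covariance (E22) gives [hZM] with ω′ = ω∘P»; road-P2 g39's E26: «t = −1».  HONEST FRAMING (cell contract, verbatim): «discharging `BetaPertH` makes Bałaban's UV stability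
UNCONDITIONAL — a real constructive-QFT result; it is NOT the continuum limit and NOT the Clay problem.»  HONEST DEPENDENCY (verbatim): «continuum YM on T⁴ ⇐ BetaPertH ∧
nine spine estimates (0/9 proved); BetaPertH ⇐ (D1) ∧ (D4) ∧ CAP+tail; G-an2-4 gates asym, D1 and NE2/3/4.»

WHAT.  A SLOT LAW of (Wr)∕(Sr) type for a table family `T : Fin (d+1) → Site → MKer`: `T μ (bref α μ y) = reflSign α μ • refK (Φ N α) (T μ y)` for every axis `α`.
* §1 **`slotLaw_iterate`** (every finite set `s` of axes: `T μ (Y_s y) x z a b = (∏_{α∈s} reflSign α μ)·(∏_{α∈s} s_a)·(∏_{α∈s} s_b)·T μ y (R_s^a x) (R_s^b z) a b`,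
  closed-form coordinates as in the companion file — induction on `s`, one rewrite by the slot law per axis, NO composition of leg maps); `prod_reflSign_univ`; **`slotLaw_pointInv`**
  (`s = univ`: `T μ (−𝟙 − y − e_μ) x z a b = −T μ y (R^a x) (R^b z) a b` — the slot sign `−1` survives, the two leg signs cancel); `slot_pointInv` (closed form of the slot map).
* §2 THE ROOTED CONSTRAINT HESSIAN AT THE CENTRED ROOT (`Lc` odd; field–field block, the other blocks vanish): **`hessFFAt_pointInv_ctr`** — the point inversion through
  the centre of `B(y)`: `hessFFAt ctr Lc ρ′ (2•y − e_ρ′ − w) x z (inl κ) (inl κ′) = −hessFFAt ctr Lc ρ′ w (c_y − e_κ − x) (c_y − e_κ′ − z) (inl κ) (inl κ′)`,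
  `c_y := Lc•(2•y) + (Lc−1)•𝟙` (§1 over `hessFFAt_reflect`, then `hessFFAt_translate` by `2•y + 𝟙`); **`M1At_pointInv_ctr`** (the same for `M1At … j ρ′`, any `cΛ`, `j`).
* §3 THE ω-CHARGE (road-P2's `hZM` shape): **`tsum_weighted_M1At_slotInv_ctr`** — for EVERY weight `ω : Site × Site → ℝ` (no summability needed: re-indexing by the
  involution `(x, z) ↦ (c_y − e_κ − x, c_y − e_κ′ − z)` is an `Equiv`), `Σ' ω(x,z)·M1At … ρ′ (2•y − e_ρ′ − w) x z (inl κ)(inl κ′) = (−1)·Σ' ω(c_y − e_κ − x, c_y − e_κ′ − z)·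
  M1At … ρ′ w x z (inl κ)(inl κ′)` — `hZM` with `t′ = −1` and `ω′ = ω ∘ (P_κ × P_κ′)`; `tsum_weighted_M1At_inr_left ∕ _right` (multiplier channels: both sides `0`).
* §4 THE CONSUMER's CLASS IS INVERSION-INVARIANT: `emod_pointInv_iff` (`(c_y − e_κ − x)_κ % Lc = Lc − 1 ↔ x_κ % Lc = Lc − 1`: an exit bond inverts to an exit bond),
  `spanExitWt_pointInv` (every `ω(x,z) = (if x_κ % Lc = Lc−1 then p₁ else q₁)·(if z_κ′ % Lc = Lc−1 then p₂ else q₂)` — the class `span{1, exit_κ} ⊗ span{1, exit_κ′}` of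
  RULING R-gan24p1-g28-1 (ii), incl. the transported currency `u_κ ⊗ u_κ′ = Lc⁻²·exit ⊗ exit` — satisfies `ω ∘ (P_κ × P_κ′) = ω`), hence **`tsum_spanExitWt_M1At_slotInv_ctr`**:
  `hZM` LITERALLY with `ω′ = ω`, `t′ = −1` for that class (the entry class `𝟙[x_κ % Lc = 0]` is NOT invariant — it inverts to `𝟙[x_κ % Lc = Lc − 2]` — consistent with E26f).
WHAT THIS FILE DOES NOT DO.  The FIELD half `hZS` of (INV-Z) — the ω-charges of the pure S table `SpureRecAt … (j+1)` under the inversion — is a CHARGE identity (the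
Wilson∕VH letters obey (Sr) only up to contact stencils: `RootedKernelReflection.vhSAt_bref`, an2's `hSrC`), an1's hand per R-g28-1 (v), and stays DISPLAYED; off-centre
roots are not claimed; nothing of (W-γ) ∕ (S) ∕ (Q-R) ∕ (LT) ∕ (Q-L) ∕ (C) ∕ «T2Shape» ∕ «T2Drift» ∕ (hW, hWall) is discharged; asserts NO value of Bałaban's tables; NEVER
«G-an2-4 closed» as (CONV-C); NOT D1, NOT `BetaPertH`, NOT continuum, NOT Clay.  2026-08-22 (gan24-formalise-leaf-02 gen 58); no existing file touched.
-/

noncomputable section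

open Finset
open scoped BigOperators
open Literature.MathematicalPhysics.QuantumFieldTheory
open Literature.MathematicalPhysics.QuantumFieldTheory.Balaban1983to89
open Literature.MathematicalPhysics.QuantumFieldTheory.Balaban1983to89.Beta
open ExpKernelCalculus (Site MKer shiftK)
open AffineAveraging (box toSite)
open AveragingContoursRooted (ctr ctrOff)
open AveragingHessianKernelsRooted (hessFFAt hessFFAt_inl_inr hessFFAt_inr hessFFAt_translate)
open PolarizationSign (reflSign)
open KernelReflection (LegMap refK refK_apply)
open ResolventReflection (bref bref_apply mref Φ Φ_r_inl Φ_r_inr Φ_s_inl Φ_s_inr)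
open RootedKernelReflection (hessFFAt_reflect)
open OneStepResolventKernel (Fib)
open BalabanStepW2 (wM1)
open Summit.QuantumFields.BalabanUV.Beta.SpineRooted (M1At)
open AveragingContours (blk)
open OneStepKernelFamily (KInvStep colH)
open SecondOrderResponse (colM dM)
open Summit.QuantumFields.BalabanUV.Beta.BorderedHessian (diagK)
open Summit.QuantumFields.BalabanUV.Beta.ChartConjugation (conjV)
open Summit.QuantumFields.BalabanUV.Beta.AveragingWardRootedStencils (legInd)
open Summit.QuantumFields.BalabanUV.Beta.AxialDressingRooted (coDressKBmAt)
open Summit.QuantumFields.BalabanUV.Beta.SpineRooted (SpureRecAt)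
open Summit.QuantumFields.BalabanUV.Beta.GAN24.CoDressedColumnPointInversion (legMap_r_apply_of_ne legMap_r_apply_self_congr prod_legSign_univ pointInv_inl
  weightedProfile_comb_slotInv_ctr weightedCharge_rotatedVertex_slotInv_ctr)

namespace Summit.QuantumFields.BalabanUV.Beta.GAN24.ConstraintHessianPointInversion

variable {d : ℕ}

/-! ## §1 Iterating a (Wr)∕(Sr)-type slot law over a finite set of axes; the total point inversion of a table family -/

/-- [folklore] **ITERATED SLOT LAW, NO COMPOSITION OF LEG MAPS.**  If the table family `T` obeys the axis-`α` slot law `T μ (bref α μ y) = reflSign α μ • refK (Φ N α) (T μ y)`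
for EVERY axis, then for every finite set `s` of axes
`T μ (i ↦ [i ∈ s] ? bref i μ y i : y i) x z a b = (∏_{α∈s} reflSign α μ)·(∏_{α∈s} (Φ N α).s a)·(∏_{α∈s} (Φ N α).s b)·T μ y (i ↦ [i ∈ s] ? (Φ N i).r a x i : x i) (i ↦ …) a b`
(induction on `s`; the reflections of distinct axes act on distinct coordinates, `CoDressedColumnPointInversion` §1). -/
theorem slotLaw_iterate {N : ℕ} {T : Fin (d + 1) → Site (d + 1) → MKer (d + 1) (Fib d)}
    (hT : ∀ (α μ : Fin (d + 1)) (y : Site (d + 1)), T μ (bref α μ y) = reflSign α μ • refK (Φ N α) (T μ y))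
    (μ : Fin (d + 1)) (s : Finset (Fin (d + 1))) (y x z : Site (d + 1)) (a b : Fib d) :
    T μ (fun i => if i ∈ s then bref i μ y i else y i) x z a b
      = (∏ α ∈ s, reflSign α μ) * (∏ α ∈ s, (Φ (d := d) N α).s a) * (∏ α ∈ s, (Φ (d := d) N α).s b)
        * T μ y (fun i => if i ∈ s then (Φ (d := d) N i).r a x i else x i) (fun i => if i ∈ s then (Φ (d := d) N i).r b z i else z i) a b := by
  classical
  induction s using Finset.induction_on generalizing x z with
  | empty => simp
  | insert α s hα ih =>
    -- the slot: one more reflection in the axis `α ∉ s`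
    have eY : (fun i => if i ∈ insert α s then bref i μ y i else y i) = bref α μ (fun i => if i ∈ s then bref i μ y i else y i) := by
      funext i
      by_cases hi : i = α
      · subst hi
        rw [if_pos (Finset.mem_insert_self i s)]
        have h := legMap_r_apply_self_congr N i (Sum.inl μ) (x := y) (x' := fun i' => if i' ∈ s then bref i' μ y i' else y i') (by simp [hα])
        simpa only [Φ_r_inl] using h
      · have h := legMap_r_apply_of_ne N α (Sum.inl μ) (fun i' => if i' ∈ s then bref i' μ y i' else y i') hi
        simp only [Φ_r_inl] at h
        rw [h]
        simp [Finset.mem_insert, hi]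
    -- the legs: the inner reflection in the axis `α`, then the `s`-reflections
    have eX : ∀ (c : Fib d) (v : Site (d + 1)),
        (fun i => if i ∈ s then (Φ (d := d) N i).r c ((Φ (d := d) N α).r c v) i else (Φ (d := d) N α).r c v i)
          = fun i => if i ∈ insert α s then (Φ (d := d) N i).r c v i else v i := by
      intro c v
      funext i
      by_cases hi : i = α
      · subst hi
        rw [if_neg hα, if_pos (Finset.mem_insert_self i s)]
      · by_cases his : i ∈ s
        · rw [if_pos his, if_pos (Finset.mem_insert_of_mem his)]
          exact legMap_r_apply_self_congr N i c (legMap_r_apply_of_ne N α c v hi)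
        · rw [if_neg his, if_neg (by simp [Finset.mem_insert, hi, his])]
          exact legMap_r_apply_of_ne N α c v hi
    rw [eY, hT α μ]
    simp only [Pi.smul_apply, smul_eq_mul, refK_apply]
    rw [ih ((Φ (d := d) N α).r a x) ((Φ (d := d) N α).r b z), eX a x, eX b z, Finset.prod_insert hα, Finset.prod_insert hα, Finset.prod_insert hα]
    ring

/-- [folklore] The product of the slot signs over ALL axes is `−1`. -/
theorem prod_reflSign_univ (μ : Fin (d + 1)) : ∏ α : Fin (d + 1), reflSign α μ = -1 := by
  simp only [reflSign]
  rw [Finset.prod_ite_eq]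
  simp

/-- [folklore] **THE TOTAL POINT INVERSION OF A TABLE FAMILY OBEYING THE SLOT LAW IN EVERY AXIS**: `T μ (i ↦ bref i μ y i) x z a b = −T μ y (R^a x) (R^b z) a b` — the slot
sign `∏_α reflSign α μ = −1` survives, the two leg signs cancel (`CoDressedColumnPointInversion.prod_legSign_univ`). -/
theorem slotLaw_pointInv {N : ℕ} {T : Fin (d + 1) → Site (d + 1) → MKer (d + 1) (Fib d)}
    (hT : ∀ (α μ : Fin (d + 1)) (y : Site (d + 1)), T μ (bref α μ y) = reflSign α μ • refK (Φ N α) (T μ y))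
    (μ : Fin (d + 1)) (y x z : Site (d + 1)) (a b : Fib d) :
    T μ (fun i => bref i μ y i) x z a b = -T μ y (fun i => (Φ (d := d) N i).r a x i) (fun i => (Φ (d := d) N i).r b z i) a b := by
  have h := slotLaw_iterate hT μ Finset.univ y x z a b
  simp only [Finset.mem_univ, if_true] at h
  rw [h, prod_reflSign_univ, prod_legSign_univ N a, prod_legSign_univ N b]
  ring

/-- [folklore] Closed form of the inverted slot: `(i ↦ bref i μ y i) = −𝟙 − y − e_μ` (a coarse bond inverts to the bond re-based at its far end). -/
theorem slot_pointInv (μ : Fin (d + 1)) (y : Site (d + 1)) :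
    (fun i => bref i μ y i) = fun i => -1 - y i - (Pi.single μ (1 : ℤ) : Site (d + 1)) i := by
  have h := pointInv_inl (d := d) 0 μ y
  simpa only [Φ_r_inl] using h

/-! ## §2 The rooted constraint Hessian and the first multiplier table at the centred root -/

section Ctr

variable {Lc : ℕ}

/-- NOT IN PRINT; OUR BOOKKEEPING.  **THE ROOTED CONSTRAINT HESSIAN IS COVARIANT UNDER THE POINT INVERSION THROUGH THE CENTRE OF ANY BLOCK** (centred root, `Lc` odd;
the field–field block — all other blocks of `hessFFAt` vanish): with `c_y := Lc•(2•y) + (Lc−1)•𝟙`,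
`hessFFAt ctr Lc ρ′ (2•y − e_ρ′ − w) x z (inl κ) (inl κ′) = −hessFFAt ctr Lc ρ′ w (c_y − e_κ − x) (c_y − e_κ′ − z) (inl κ) (inl κ′)`
(§1 over an1∕an5's `hessFFAt_reflect`, then the block translation `hessFFAt_translate` by `2•y + 𝟙`).  The slot `(ρ′, w)` is a coarse bond, the legs are fine bonds; all three
invert to the bond re-based at its far end, each with sign `−1`. -/
theorem hessFFAt_pointInv_ctr (hLc : Odd Lc) (ρ' : Fin (d + 1)) (y w x z : Site (d + 1)) (κ κ' : Fin (d + 1)) :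
    hessFFAt (ctr (d + 1) Lc) Lc ρ' ((2 : ℕ) • y - Pi.single ρ' 1 - w) x z (Sum.inl κ) (Sum.inl κ')
      = -hessFFAt (ctr (d + 1) Lc) Lc ρ' w
          ((Lc : ℤ) • ((2 : ℕ) • y) + toSite (fun _ : Fin (d + 1) => Lc - 1) - Pi.single κ 1 - x)
          ((Lc : ℤ) • ((2 : ℕ) • y) + toSite (fun _ : Fin (d + 1) => Lc - 1) - Pi.single κ' 1 - z) (Sum.inl κ) (Sum.inl κ') := by
  have hLc1 : 1 ≤ Lc := hLc.pos
  -- split the inverted slot as (inversion through `−½𝟙`) + (translation by `2•y + 𝟙`)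
  have eslot : ((2 : ℕ) • y - Pi.single ρ' 1 - w : Site (d + 1)) = (fun i => bref i ρ' w i) + ((2 : ℕ) • y + fun _ => (1 : ℤ)) := by
    rw [slot_pointInv]
    funext i
    simp only [Pi.add_apply, Pi.sub_apply]
    ring
  rw [eslot, hessFFAt_translate]
  simp only [shiftK]
  rw [slotLaw_pointInv (fun α μ v => hessFFAt_reflect (n := d) hLc Lc α μ v) ρ' w, pointInv_inl, pointInv_inl]
  congr 2
  · funext i
    simp only [Pi.add_apply, Pi.sub_apply, Pi.neg_apply, Pi.smul_apply, smul_eq_mul, toSite, Nat.cast_sub hLc1, Nat.cast_one, Pi.single_apply]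
    ring
  · funext i
    simp only [Pi.add_apply, Pi.sub_apply, Pi.neg_apply, Pi.smul_apply, smul_eq_mul, toSite, Nat.cast_sub hLc1, Nat.cast_one, Pi.single_apply]
    ring

/-- NOT IN PRINT; OUR BOOKKEEPING.  **THE FIRST MULTIPLIER TABLE `M1At … j ρ′ = (cΛ·wM1_j) • hessFFAt` UNDER THE INVERSION THROUGH THE CENTRE OF `B(y)`** (centred root
`toSite (ctrOff (d+1) Lc)`, `Lc` odd, every `cΛ`, `j`; field–field block):
`M1At … ρ′ (2•y − e_ρ′ − w) x z (inl κ)(inl κ′) = −M1At … ρ′ w (c_y − e_κ − x) (c_y − e_κ′ − z) (inl κ)(inl κ′)`. -/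
theorem M1At_pointInv_ctr [NeZero Lc] (hLc : Odd Lc) (cΛ : ℝ) (j : ℕ) (ρ' : Fin (d + 1)) (y w x z : Site (d + 1)) (κ κ' : Fin (d + 1)) :
    M1At d Lc (toSite (ctrOff (d + 1) Lc)) cΛ j ρ' ((2 : ℕ) • y - Pi.single ρ' 1 - w) x z (Sum.inl κ) (Sum.inl κ')
      = -M1At d Lc (toSite (ctrOff (d + 1) Lc)) cΛ j ρ' w
          ((Lc : ℤ) • ((2 : ℕ) • y) + toSite (fun _ : Fin (d + 1) => Lc - 1) - Pi.single κ 1 - x)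
          ((Lc : ℤ) • ((2 : ℕ) • y) + toSite (fun _ : Fin (d + 1) => Lc - 1) - Pi.single κ' 1 - z) (Sum.inl κ) (Sum.inl κ') := by
  simp only [M1At, Pi.smul_apply, smul_eq_mul]
  rw [show toSite (ctrOff (d + 1) Lc) = ctr (d + 1) Lc from rfl, hessFFAt_pointInv_ctr hLc]
  ring

/-! ## §3 The ω-charge of the multiplier table: road-P2's `hZM` with `t′ = −1`, `ω′ = ω ∘ (P_κ × P_κ′)` -/

/-- NOT IN PRINT; OUR BOOKKEEPING.  **(INV-Z), MULTIPLIER HALF — `hZM` OF `WardResidualRotatedVertexInversion.weightedProfile_comb_slotInv` WITH `t′ = −1` AND THE INVERTED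
WEIGHT** (centred root, `Lc` odd, every `cΛ`, `j`, label `y`, field channel `(inl κ, inl κ′)`, EVERY weight `ω`, no summability asked — both sides are re-indexings of one
another by the involution `(x, z) ↦ (c_y − e_κ − x, c_y − e_κ′ − z)`):
`Σ'_{(x,z)} ω(x,z)·M1At … ρ′ (2•y − e_ρ′ − w) x z (inl κ)(inl κ′) = (−1)·Σ'_{(x,z)} ω(c_y − e_κ − x, c_y − e_κ′ − z)·M1At … ρ′ w x z (inl κ)(inl κ′)`. -/
theorem tsum_weighted_M1At_slotInv_ctr [NeZero Lc] (hLc : Odd Lc) (cΛ : ℝ) (j : ℕ) (y : Site (d + 1)) (κ κ' : Fin (d + 1))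
    (ω : Site (d + 1) × Site (d + 1) → ℝ) (ρ' : Fin (d + 1)) (w : Site (d + 1)) :
    ∑' xz : Site (d + 1) × Site (d + 1), ω xz * M1At d Lc (toSite (ctrOff (d + 1) Lc)) cΛ j ρ' ((2 : ℕ) • y - Pi.single ρ' 1 - w) xz.1 xz.2 (Sum.inl κ) (Sum.inl κ')
      = (-1) * ∑' xz : Site (d + 1) × Site (d + 1),
          ω ((Lc : ℤ) • ((2 : ℕ) • y) + toSite (fun _ : Fin (d + 1) => Lc - 1) - Pi.single κ 1 - xz.1,
              (Lc : ℤ) • ((2 : ℕ) • y) + toSite (fun _ : Fin (d + 1) => Lc - 1) - Pi.single κ' 1 - xz.2)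
            * M1At d Lc (toSite (ctrOff (d + 1) Lc)) cΛ j ρ' w xz.1 xz.2 (Sum.inl κ) (Sum.inl κ') := by
  let E : Site (d + 1) × Site (d + 1) ≃ Site (d + 1) × Site (d + 1) :=
    (Equiv.subLeft (((Lc : ℤ) • ((2 : ℕ) • y) + toSite (fun _ : Fin (d + 1) => Lc - 1) - Pi.single κ 1 : Site (d + 1)))).prodCongr
      (Equiv.subLeft (((Lc : ℤ) • ((2 : ℕ) • y) + toSite (fun _ : Fin (d + 1) => Lc - 1) - Pi.single κ' 1 : Site (d + 1))))
  rw [neg_one_mul, ← tsum_neg]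
  refine ((E.tsum_eq _).symm.trans ?_).symm
  refine tsum_congr fun xz => ?_
  simp only [E, Equiv.prodCongr_apply, Prod.map, Equiv.subLeft_apply, sub_sub_cancel]
  rw [M1At_pointInv_ctr hLc]
  ring

/-- [folklore] Multiplier channels carry no `M1At` charge: a left multiplier leg gives `0` on both sides of `hZM` (any slot, any weight). -/
theorem tsum_weighted_M1At_inr_left [NeZero Lc] (ρc : Site (d + 1)) (cΛ : ℝ) (j : ℕ) (ω : Site (d + 1) × Site (d + 1) → ℝ) (ρ' : Fin (d + 1))
    (w : Site (d + 1)) (m : Fin (d + 1)) (b : Fib d) :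
    ∑' xz : Site (d + 1) × Site (d + 1), ω xz * M1At d Lc ρc cΛ j ρ' w xz.1 xz.2 (Sum.inr m) b = 0 := by
  have h : ∀ xz : Site (d + 1) × Site (d + 1), ω xz * M1At d Lc ρc cΛ j ρ' w xz.1 xz.2 (Sum.inr m) b = 0 := fun xz => by
    simp only [M1At, Pi.smul_apply, smul_eq_mul, hessFFAt_inr, mul_zero]
  simp only [h, tsum_zero]

/-- [folklore] … and so does a right multiplier leg. -/
theorem tsum_weighted_M1At_inr_right [NeZero Lc] (ρc : Site (d + 1)) (cΛ : ℝ) (j : ℕ) (ω : Site (d + 1) × Site (d + 1) → ℝ) (ρ' : Fin (d + 1))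
    (w : Site (d + 1)) (κ m : Fin (d + 1)) :
    ∑' xz : Site (d + 1) × Site (d + 1), ω xz * M1At d Lc ρc cΛ j ρ' w xz.1 xz.2 (Sum.inl κ) (Sum.inr m) = 0 := by
  have h : ∀ xz : Site (d + 1) × Site (d + 1), ω xz * M1At d Lc ρc cΛ j ρ' w xz.1 xz.2 (Sum.inl κ) (Sum.inr m) = 0 := fun xz => by
    simp only [M1At, Pi.smul_apply, smul_eq_mul, hessFFAt_inl_inr, mul_zero]
  simp only [h, tsum_zero]

/-! ## §4 The consumer's class `span{1, exit_κ} ⊗ span{1, exit_κ′}` is inversion-invariant; `hZM` literally with `ω′ = ω` -/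

/-- [folklore] `(−2 − t) % L = L − 1 ↔ t % L = L − 1` (`1 ≤ L`): both say `L ∣ t + 1`. -/
theorem emod_neg_two_sub_iff (hL : 1 ≤ Lc) (t : ℤ) : (-2 - t) % (Lc : ℤ) = (Lc : ℤ) - 1 ↔ t % (Lc : ℤ) = (Lc : ℤ) - 1 := by
  have hL0 : (0 : ℤ) < Lc := by exact_mod_cast hL
  have key : ∀ u : ℤ, u % (Lc : ℤ) = (Lc : ℤ) - 1 ↔ (Lc : ℤ) ∣ u + 1 := by
    intro u
    constructor
    · intro h
      have e := Int.emod_add_ediv_mul u (Lc : ℤ)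
      refine ⟨u / (Lc : ℤ) + 1, ?_⟩
      linear_combination -e + h
    · rintro ⟨k, hk⟩
      have eu : u = (Lc : ℤ) - 1 + (Lc : ℤ) * (k - 1) := by linear_combination hk
      rw [eu, Int.add_mul_emod_self_left]
      exact Int.emod_eq_of_lt (by linarith) (by linarith)
  rw [key, key, show -2 - t + 1 = -(t + 1) by ring, Int.dvd_neg]

/-- [folklore] **AN EXIT BOND INVERTS TO AN EXIT BOND**: for the fine inversion `x ↦ c_y − e_κ − x` of `κ`-legs, `(c_y − e_κ − x)_κ % Lc = Lc − 1 ↔ x_κ % Lc = Lc − 1` (`1 ≤ Lc`). -/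
theorem emod_pointInv_iff (hLc : 1 ≤ Lc) (y x : Site (d + 1)) (κ : Fin (d + 1)) :
    ((Lc : ℤ) • ((2 : ℕ) • y) + toSite (fun _ : Fin (d + 1) => Lc - 1) - Pi.single κ 1 - x : Site (d + 1)) κ % (Lc : ℤ) = (Lc : ℤ) - 1
      ↔ x κ % (Lc : ℤ) = (Lc : ℤ) - 1 := by
  have e : ((Lc : ℤ) • ((2 : ℕ) • y) + toSite (fun _ : Fin (d + 1) => Lc - 1) - Pi.single κ 1 - x : Site (d + 1)) κ
      = (-2 - x κ) + (Lc : ℤ) * (2 * y κ + 1) := by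
    simp only [Pi.add_apply, Pi.sub_apply, Pi.smul_apply, smul_eq_mul, toSite, Nat.cast_sub hLc, Nat.cast_one, Pi.single_apply, if_true]
    ring
  rw [e, Int.add_mul_emod_self_left, emod_neg_two_sub_iff hLc]

/-- [folklore] **THE CLASS `span{1, exit_κ} ⊗ span{1, exit_κ′}` IS INVERSION-INVARIANT**: every weight `ω(x,z) = (if x_κ % Lc = Lc−1 then p₁ else q₁)·(if z_κ′ % Lc = Lc−1
then p₂ else q₂)` (plain: `p = q`; exit: `q = 0`; the transported currency `u = Lc⁻²·exit`) satisfies `ω(c_y − e_κ − x, c_y − e_κ′ − z) = ω(x, z)`.  (The ENTRY class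
`𝟙[x_κ % Lc = 0]` inverts to `𝟙[x_κ % Lc = Lc − 2]` and is NOT in this class.) -/
theorem spanExitWt_pointInv (hLc : 1 ≤ Lc) (y : Site (d + 1)) (κ κ' : Fin (d + 1)) (p₁ q₁ p₂ q₂ : ℝ) (x z : Site (d + 1)) :
    (if ((Lc : ℤ) • ((2 : ℕ) • y) + toSite (fun _ : Fin (d + 1) => Lc - 1) - Pi.single κ 1 - x : Site (d + 1)) κ % (Lc : ℤ) = (Lc : ℤ) - 1 then p₁ else q₁)
        * (if ((Lc : ℤ) • ((2 : ℕ) • y) + toSite (fun _ : Fin (d + 1) => Lc - 1) - Pi.single κ' 1 - z : Site (d + 1)) κ' % (Lc : ℤ) = (Lc : ℤ) - 1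
            then p₂ else q₂)
      = (if x κ % (Lc : ℤ) = (Lc : ℤ) - 1 then p₁ else q₁) * (if z κ' % (Lc : ℤ) = (Lc : ℤ) - 1 then p₂ else q₂) := by
  simp only [emod_pointInv_iff hLc]

/-- NOT IN PRINT; OUR BOOKKEEPING.  **`hZM` LITERALLY, WITH `ω′ = ω` AND `t′ = −1`, FOR THE CLASS `span{1, exit_κ} ⊗ span{1, exit_κ′}`** (centred root, `Lc` odd, every `cΛ`,
`j`, label `y`, coefficients `p₁ q₁ p₂ q₂`, field channel `(inl κ, inl κ′)`): with `ω(x,z) := (if x_κ % Lc = Lc−1 then p₁ else q₁)·(if z_κ′ % Lc = Lc−1 then p₂ else q₂)`,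
`Σ' ω·M1At … ρ′ (2•y − e_ρ′ − w) x z (inl κ)(inl κ′) = (−1)·Σ' ω·M1At … ρ′ w x z (inl κ)(inl κ′)` for EVERY multiplier slot `(ρ′, w)` — the hypothesis `hZM` of road-P2 g39's
`weightedProfile_comb_slotInv` ∕ `weightedCharge_rotatedVertex_slotInv` (and of the companion file's `…_ctr` re-issues) DISCHARGED in the (S) row's currency. -/
theorem tsum_spanExitWt_M1At_slotInv_ctr [NeZero Lc] (hLc : Odd Lc) (cΛ : ℝ) (j : ℕ) (y : Site (d + 1)) (κ κ' : Fin (d + 1)) (p₁ q₁ p₂ q₂ : ℝ)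
    (ρ' : Fin (d + 1)) (w : Site (d + 1)) :
    ∑' xz : Site (d + 1) × Site (d + 1),
        ((if xz.1 κ % (Lc : ℤ) = (Lc : ℤ) - 1 then p₁ else q₁) * (if xz.2 κ' % (Lc : ℤ) = (Lc : ℤ) - 1 then p₂ else q₂))
          * M1At d Lc (toSite (ctrOff (d + 1) Lc)) cΛ j ρ' ((2 : ℕ) • y - Pi.single ρ' 1 - w) xz.1 xz.2 (Sum.inl κ) (Sum.inl κ')
      = (-1) * ∑' xz : Site (d + 1) × Site (d + 1),
          ((if xz.1 κ % (Lc : ℤ) = (Lc : ℤ) - 1 then p₁ else q₁) * (if xz.2 κ' % (Lc : ℤ) = (Lc : ℤ) - 1 then p₂ else q₂))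
            * M1At d Lc (toSite (ctrOff (d + 1) Lc)) cΛ j ρ' w xz.1 xz.2 (Sum.inl κ) (Sum.inl κ') := by
  rw [tsum_weighted_M1At_slotInv_ctr hLc cΛ j y κ κ'
    (fun xz : Site (d + 1) × Site (d + 1) => (if xz.1 κ % (Lc : ℤ) = (Lc : ℤ) - 1 then p₁ else q₁) * (if xz.2 κ' % (Lc : ℤ) = (Lc : ℤ) - 1 then p₂ else q₂)) ρ' w]
  congr 1
  refine tsum_congr fun xz => ?_
  rw [spanExitWt_pointInv hLc.pos y κ κ' p₁ q₁ p₂ q₂ xz.1 xz.2]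

/-! ## §5 The consumer at the centred root in the (S) row's currency: (INV-X-geo) modulo the FIELD-table charge covariance `hZS` ALONE -/

/-- NOT IN PRINT; OUR BOOKKEEPING.  **ROAD-P2's `weightedProfile_comb_slotInv` AT THE CENTRED ROOT, IN THE CLASS `span{1, exit_κ₀} ⊗ span{1, exit_κ₀′}`, WITH (INV-G) AND THE
MULTIPLIER HALF OF (INV-Z) DISCHARGED** (`Lc` odd; `ε = −1`, `ω′ = ω`; companion `CoDressedColumnPointInversion.weightedProfile_comb_slotInv_ctr` ⨾ §4): the ONE remaining displayed
hypothesis is the FIELD half `hZS` — the ω-charges of the pure S table `SpureRecAt … (j+1)` flip sign under the fine inversion of the slot leg (an1's charge identity). -/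
theorem weightedProfile_comb_slotInv_ctr_spanExit [NeZero Lc] (hLc : Odd Lc) (cE cVH cΛ : ℝ) (j : ℕ) (y : Site (d + 1)) (ν κ₀ κ₀' : Fin (d + 1))
    (p₁ q₁ p₂ q₂ : ℝ)
    (hZS : ∀ (κ : Fin (d + 1)) (u : Site (d + 1)),
      ∑' xz : Site (d + 1) × Site (d + 1),
          ((if xz.1 κ₀ % (Lc : ℤ) = (Lc : ℤ) - 1 then p₁ else q₁) * (if xz.2 κ₀' % (Lc : ℤ) = (Lc : ℤ) - 1 then p₂ else q₂))
            * SpureRecAt d Lc (toSite (ctrOff (d + 1) Lc)) cE cVH cΛ (j + 1) κ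
              ((Lc : ℤ) • ((2 : ℕ) • y) + toSite (fun _ : Fin (d + 1) => Lc - 1) - Pi.single κ 1 - u) xz.1 xz.2 (Sum.inl κ₀) (Sum.inl κ₀')
        = (-1) * ∑' xz : Site (d + 1) × Site (d + 1),
          ((if xz.1 κ₀ % (Lc : ℤ) = (Lc : ℤ) - 1 then p₁ else q₁) * (if xz.2 κ₀' % (Lc : ℤ) = (Lc : ℤ) - 1 then p₂ else q₂))
            * SpureRecAt d Lc (toSite (ctrOff (d + 1) Lc)) cE cVH cΛ (j + 1) κ u xz.1 xz.2 (Sum.inl κ₀) (Sum.inl κ₀'))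
    (y' : Site (d + 1)) :
    (1 / 2 : ℝ) *
        ((∑ κ : Fin (d + 1), ∑' u : Site (d + 1),
            colH (coDressKBmAt (toSite (ctrOff (d + 1) Lc)) Lc (KInvStep (d := d) Lc (j + 1))) Lc ν ((2 : ℕ) • y - Pi.single ν 1 - y') κ u
              * ((if (2 : ℕ) • y - Pi.single ν 1 - y' = y then (1 / 2 : ℝ) else 0) - (if blk Lc u = y then (1 / 2 : ℝ) else 0))
              * ∑' xz : Site (d + 1) × Site (d + 1),
                  ((if xz.1 κ₀ % (Lc : ℤ) = (Lc : ℤ) - 1 then p₁ else q₁) * (if xz.2 κ₀' % (Lc : ℤ) = (Lc : ℤ) - 1 then p₂ else q₂))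
                    * SpureRecAt d Lc (toSite (ctrOff (d + 1) Lc)) cE cVH cΛ (j + 1) κ u xz.1 xz.2 (Sum.inl κ₀) (Sum.inl κ₀'))
          + ∑ ρ' : Fin (d + 1), ∑' w : Site (d + 1),
            colM (coDressKBmAt (toSite (ctrOff (d + 1) Lc)) Lc (KInvStep (d := d) Lc (j + 1))) Lc ν ((2 : ℕ) • y - Pi.single ν 1 - y') ρ' w
              * ((if (2 : ℕ) • y - Pi.single ν 1 - y' = y then (1 / 2 : ℝ) else 0) - (if w = y then (1 / 2 : ℝ) else 0))
              * ∑' xz : Site (d + 1) × Site (d + 1),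
                  ((if xz.1 κ₀ % (Lc : ℤ) = (Lc : ℤ) - 1 then p₁ else q₁) * (if xz.2 κ₀' % (Lc : ℤ) = (Lc : ℤ) - 1 then p₂ else q₂))
                    * M1At d Lc (toSite (ctrOff (d + 1) Lc)) cΛ (j + 1) ρ' w xz.1 xz.2 (Sum.inl κ₀) (Sum.inl κ₀'))
      = (-1) * ((1 / 2 : ℝ) *
        ((∑ κ : Fin (d + 1), ∑' u : Site (d + 1),
            colH (coDressKBmAt (toSite (ctrOff (d + 1) Lc)) Lc (KInvStep (d := d) Lc (j + 1))) Lc ν y' κ u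
              * ((if y' + Pi.single ν 1 = y then (1 / 2 : ℝ) else 0) - (if blk Lc (u + Pi.single κ 1) = y then (1 / 2 : ℝ) else 0))
              * ∑' xz : Site (d + 1) × Site (d + 1),
                  ((if xz.1 κ₀ % (Lc : ℤ) = (Lc : ℤ) - 1 then p₁ else q₁) * (if xz.2 κ₀' % (Lc : ℤ) = (Lc : ℤ) - 1 then p₂ else q₂))
                    * SpureRecAt d Lc (toSite (ctrOff (d + 1) Lc)) cE cVH cΛ (j + 1) κ u xz.1 xz.2 (Sum.inl κ₀) (Sum.inl κ₀'))
          + ∑ ρ' : Fin (d + 1), ∑' w : Site (d + 1),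
            colM (coDressKBmAt (toSite (ctrOff (d + 1) Lc)) Lc (KInvStep (d := d) Lc (j + 1))) Lc ν y' ρ' w
              * ((if y' + Pi.single ν 1 = y then (1 / 2 : ℝ) else 0) - (if w + Pi.single ρ' 1 = y then (1 / 2 : ℝ) else 0))
              * ∑' xz : Site (d + 1) × Site (d + 1),
                  ((if xz.1 κ₀ % (Lc : ℤ) = (Lc : ℤ) - 1 then p₁ else q₁) * (if xz.2 κ₀' % (Lc : ℤ) = (Lc : ℤ) - 1 then p₂ else q₂))
                    * M1At d Lc (toSite (ctrOff (d + 1) Lc)) cΛ (j + 1) ρ' w xz.1 xz.2 (Sum.inl κ₀) (Sum.inl κ₀'))) :=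
  weightedProfile_comb_slotInv_ctr hLc cE cVH cΛ j y ν (Sum.inl κ₀) (Sum.inl κ₀')
    (fun xz => (if xz.1 κ₀ % (Lc : ℤ) = (Lc : ℤ) - 1 then p₁ else q₁) * (if xz.2 κ₀' % (Lc : ℤ) = (Lc : ℤ) - 1 then p₂ else q₂))
    (fun xz => (if xz.1 κ₀ % (Lc : ℤ) = (Lc : ℤ) - 1 then p₁ else q₁) * (if xz.2 κ₀' % (Lc : ℤ) = (Lc : ℤ) - 1 then p₂ else q₂)) (-1) hZS
    (fun ρ' w => tsum_spanExitWt_M1At_slotInv_ctr hLc cΛ (j + 1) y κ₀ κ₀' p₁ q₁ p₂ q₂ ρ' w) y'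

/-- NOT IN PRINT; OUR BOOKKEEPING.  **ROAD-P2's `weightedCharge_rotatedVertex_slotInv` AT THE CENTRED ROOT IN THE SAME CLASS, (INV-G) AND THE MULTIPLIER HALF OF (INV-Z)
DISCHARGED** (`Lc` odd, `ε = −1`, `ω′ = ω`): if the ω-charge of the END-POINT rotated vertex `(α⁺)_y` at the slot `(ν, y′)` is `v`, then — given ONLY the field-table charge law
`hZS` — the ω-charge of `(α)_y` at the inverted slot `(ν, 2•y − e_ν − y′)` is `−v`.  (INV-X-geo) of RULING R-gan24p1-g28-1 (i) in the (S) row's currency, modulo `hZS` alone. -/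
theorem weightedCharge_rotatedVertex_slotInv_ctr_spanExit [NeZero Lc] (hLc : Odd Lc) (cE cVH cΛ : ℝ) (j : ℕ) (y : Site (d + 1)) (ν κ₀ κ₀' : Fin (d + 1))
    (p₁ q₁ p₂ q₂ : ℝ)
    (hZS : ∀ (κ : Fin (d + 1)) (u : Site (d + 1)),
      ∑' xz : Site (d + 1) × Site (d + 1),
          ((if xz.1 κ₀ % (Lc : ℤ) = (Lc : ℤ) - 1 then p₁ else q₁) * (if xz.2 κ₀' % (Lc : ℤ) = (Lc : ℤ) - 1 then p₂ else q₂))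
            * SpureRecAt d Lc (toSite (ctrOff (d + 1) Lc)) cE cVH cΛ (j + 1) κ
              ((Lc : ℤ) • ((2 : ℕ) • y) + toSite (fun _ : Fin (d + 1) => Lc - 1) - Pi.single κ 1 - u) xz.1 xz.2 (Sum.inl κ₀) (Sum.inl κ₀')
        = (-1) * ∑' xz : Site (d + 1) × Site (d + 1),
          ((if xz.1 κ₀ % (Lc : ℤ) = (Lc : ℤ) - 1 then p₁ else q₁) * (if xz.2 κ₀' % (Lc : ℤ) = (Lc : ℤ) - 1 then p₂ else q₂))
            * SpureRecAt d Lc (toSite (ctrOff (d + 1) Lc)) cE cVH cΛ (j + 1) κ u xz.1 xz.2 (Sum.inl κ₀) (Sum.inl κ₀'))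
    (y' : Site (d + 1)) {v : ℝ}
    (hv : HasSum (fun xz : Site (d + 1) × Site (d + 1) =>
        ((if xz.1 κ₀ % (Lc : ℤ) = (Lc : ℤ) - 1 then p₁ else q₁) * (if xz.2 κ₀' % (Lc : ℤ) = (Lc : ℤ) - 1 then p₂ else q₂)) *
        ((1 / 2 : ℝ) • dM (conjV (coDressKBmAt (toSite (ctrOff (d + 1) Lc)) Lc (KInvStep (d := d) Lc (j + 1))) (diagK (fun z c =>
            (((1 : ℝ) / 2) • ∑ v ∈ box (d + 1) Lc, legInd (toSite (ctrOff (d + 1) Lc)) ((Lc : ℤ) • y + toSite v))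
              (z + Sum.elim (fun κ => (Pi.single κ 1 : Site (d + 1))) (fun μ => (Lc : ℤ) • (Pi.single μ 1 : Site (d + 1))) c) c))) Lc
          (SpureRecAt d Lc (toSite (ctrOff (d + 1) Lc)) cE cVH cΛ (j + 1)) (M1At d Lc (toSite (ctrOff (d + 1) Lc)) cΛ (j + 1)) ν y') xz.1 xz.2
          (Sum.inl κ₀) (Sum.inl κ₀')) v) :
    HasSum (fun xz : Site (d + 1) × Site (d + 1) =>
        ((if xz.1 κ₀ % (Lc : ℤ) = (Lc : ℤ) - 1 then p₁ else q₁) * (if xz.2 κ₀' % (Lc : ℤ) = (Lc : ℤ) - 1 then p₂ else q₂)) *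
        ((1 / 2 : ℝ) • dM (conjV (coDressKBmAt (toSite (ctrOff (d + 1) Lc)) Lc (KInvStep (d := d) Lc (j + 1)))
            (diagK (((1 : ℝ) / 2) • ∑ v ∈ box (d + 1) Lc, legInd (toSite (ctrOff (d + 1) Lc)) ((Lc : ℤ) • y + toSite v)))) Lc
          (SpureRecAt d Lc (toSite (ctrOff (d + 1) Lc)) cE cVH cΛ (j + 1)) (M1At d Lc (toSite (ctrOff (d + 1) Lc)) cΛ (j + 1)) ν
          ((2 : ℕ) • y - Pi.single ν 1 - y')) xz.1 xz.2 (Sum.inl κ₀) (Sum.inl κ₀'))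
      ((-1) * v) := by
  have hω : ∀ xz : Site (d + 1) × Site (d + 1),
      |(if xz.1 κ₀ % (Lc : ℤ) = (Lc : ℤ) - 1 then p₁ else q₁) * (if xz.2 κ₀' % (Lc : ℤ) = (Lc : ℤ) - 1 then p₂ else q₂)|
        ≤ max |p₁| |q₁| * max |p₂| |q₂| := fun xz => by
    have h1 : |(if xz.1 κ₀ % (Lc : ℤ) = (Lc : ℤ) - 1 then p₁ else q₁)| ≤ max |p₁| |q₁| := by
      split_ifs
      · exact le_max_left _ _
      · exact le_max_right _ _
    have h2 : |(if xz.2 κ₀' % (Lc : ℤ) = (Lc : ℤ) - 1 then p₂ else q₂)| ≤ max |p₂| |q₂| := by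
      split_ifs
      · exact le_max_left _ _
      · exact le_max_right _ _
    rw [abs_mul]
    exact mul_le_mul h1 h2 (abs_nonneg _) ((abs_nonneg _).trans h1)
  exact weightedCharge_rotatedVertex_slotInv_ctr hLc cE cVH cΛ j y ν (Sum.inl κ₀) (Sum.inl κ₀') hω (-1) hZS
    (fun ρ' w => tsum_spanExitWt_M1At_slotInv_ctr hLc cΛ (j + 1) y κ₀ κ₀' p₁ q₁ p₂ q₂ ρ' w) y' hω hv

end Ctr

end Summit.QuantumFields.BalabanUV.Beta.GAN24.ConstraintHessianPointInversion

end
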